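import Summits.ResolutionOfSingularities.ResolutionOfSingularities.Theorems.FrobeniusClosingPatchingRelPerfectDepthPhaseCLocalGameGlobalStep
import Literature.AlgebraicGeometry.Resolution.BlowupSequencesAppend
import Literature.AlgebraicGeometry.Resolution.BlowupsIntegral
import Literature.AlgebraicGeometry.Resolution.BlowupRestrictOpen
import Summits.ResolutionOfSingularities.ResolutionOfSingularities.Theorems.FrobeniusClosingPatchingRelPerfectDepthFlagCascadeCompanion
import HarnessLib

/-!
# [OURS · L1 W5.2 · (β-AX) X3 C-I (G-T) (iii′)] THE GLOBAL ENGINE SOCKET UNDER (H-pt): order reduction from a well-founded component choice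

Sub-problem `ResolutionOfSingularities`, crux `PatchingRelPerfect` (stmt-ResolutionOfSingularities-16161), line
`Cruxes/PatchingRelPerfect/Lines/closed_point_slice.lean`, engine (G2), Prop `X3LemmaM.EndOrderReduction m` of `…DepthPhaseCX3Defs`.

res-D-pv-001 (iii′) NOTE 1 §3–§5: with the global move `endGlobalStep` (blow up an irreducible component of an order locus `singGE K c`,
`c ≥ m`; file `…LocalGameGlobalStep`) the whole of (G-T) under the END notion of record (H-pt) reduces to ONE combinatorial / intrinsic
statement: **a well-founded measure `μ (Y, K)` that drops under SOME such move whenever `singGE K m ≠ ∅`.**  This file is that socket: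

* **`endOrderReduction_of_wellFounded_componentChoice`** — given `μ : (Y, K) ↦ Ω` into a well-founded order and, for every regular
  Noetherian `Y` and locally-END `K` with `singGE K m ≠ ∅`, an irreducible component `Z` of some `singGE K c` (`m ≤ c`) such that `μ` drops
  for the factor `K₁` of `K·𝒪 = (𝓘_Z·𝒪)^m · K₁` on `Bl_Z Y`: the conclusion of `EndOrderReduction m` holds for every locally-END `K` on every
  regular Noetherian `X` (well-founded induction; each step is `endGlobalStep`; the order locus of `K₁` lies over that of `K`);
  **`endOrderReduction_of_wellFounded_componentChoice_history`** — the same with a history list of exceptional divisors threaded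
  through the measure (strict transforms `++` the new exceptional divisor), the shape BM-type invariants need.

No choice of centres inside pieces, no patching, no invariant gluing: the centres are global by construction.  What remains OPEN is the
measure ((iii′) NOTE 1 §4: experimentally the component-restricted game is winnable with no loss against Route K on 8248 states).

## References
* E. Bierstone, P. Milman, *Desingularization of toric and binomial varieties* (2006), arXiv:math/0411340, Thm. 8.5, Lemma 8.7. [BierstoneMilman2006]
* J. Kollár, *Lectures on Resolution of Singularities* (2007), (3.111) Step 3. [Kollar2007]
* U. Görtz, T. Wedhorn, *Algebraic Geometry I* (2nd ed. 2020), Prop. 13.91 (3). [GortzWedhorn2020]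
-/

-- `Summit.<Summit>.<Sub>.Theorems` with `Sub = Summit` (single-conjunct summit, D-0017)
set_option linter.dupNamespace false

noncomputable section

namespace Summit.ResolutionOfSingularities.ResolutionOfSingularities.Theorems.X3LemmaM

open CategoryTheory AlgebraicGeometry TopologicalSpace IsLocalRing
open Literature.AlgebraicGeometry.Resolution
open Scheme.IdealSheafData

universe u v

variable {X : Scheme.{u}}

/-! ## §1 Tools -/

/-- Off the order locus the order is below the threshold. [cite: BierstoneGrigorievMilmanWlodarczyk2011, Def. 3.1.2] -/
theorem idealOrder_lt_of_not_mem_singGE (K : X.IdealSheafData) (m : ℕ) {x : X} (hx : x ∉ singGE K m) :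
    idealOrder K x < (m : ℕ∞) := by
  by_contra hlt
  exact hx ((MarkedIdeal.mem_support_iff (⟨K, [], m⟩ : MarkedIdeal X) x).mpr ((le_idealOrder_iff K x m).mp (not_lt.mp hlt)))

/-- **The order locus of the factor lies over the order locus**: if `K·𝒪 = M · K₁` on the blow-up along a centre `C` inside
`singGE K m`, then `singGE K₁ m ⊆ π⁻¹ singGE K m` (off `π⁻¹ V(C)` the blow-up is a local isomorphism, and `K·𝒪 ⊆ K₁`).
[cite: GortzWedhorn2020, Prop. 13.91 (3)] -/
theorem singGE_factor_subset_preimage [IsLocallyNoetherian X] {K C : X.IdealSheafData} {m : ℕ}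
    (hC : (C.support : Set X) ⊆ singGE K m) {M K₁ : (blowup C).IdealSheafData}
    (hfac : K.comap (blowup.π C) = M * K₁) : singGE K₁ m ⊆ blowup.π C ⁻¹' singGE K m := by
  intro y hy
  by_contra hyS
  haveI : IsLocallyNoetherian (blowup C) := CentreSeq.isLocallyNoetherian_blowup C
  set V : (blowup C).Opens := blowup.π C ⁻¹ᵁ centreCompl C with hVdef
  haveI hφ : IsOpenImmersion (V.ι ≫ blowup.π C) := (blowup.isBlowup C).isOpenImmersion_preimage_compl_ι
  have hyV : y ∈ V := fun h => hyS (hC h)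
  have h1 := idealOrder_comap_of_isOpenImmersion V.ι (K.comap (blowup.π C)) ⟨y, hyV⟩
  rw [← Scheme.IdealSheafData.comap_comp, idealOrder_comap_of_isOpenImmersion (V.ι ≫ blowup.π C)] at h1
  change idealOrder K ((blowup.π C).base y) = idealOrder (K.comap (blowup.π C)) y at h1
  have hlt : idealOrder K ((blowup.π C).base y) < (m : ℕ∞) := idealOrder_lt_of_not_mem_singGE K m hyS
  have hle : K.comap (blowup.π C) ≤ K₁ := by rw [hfac]; exact mul_le_of_le_one_left bot_le le_top
  have h2 : idealOrder K₁ y < (m : ℕ∞) := (DepthCascade.idealOrder_anti' hle y).trans_lt (h1 ▸ hlt)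
  exact (not_le.mpr h2) ((le_idealOrder_iff K₁ y m).mpr ((MarkedIdeal.mem_support_iff (⟨K₁, [], m⟩ : MarkedIdeal (blowup C)) y).mp hy))

/-! ## §2 The socket -/

/-- [OURS · L1 W5.2 · (iii′)] **THE GLOBAL ENGINE SOCKET UNDER (H-pt).**  Let `Ω` be well-founded and `μ : (Y, K) ↦ Ω`.  Suppose that for
every regular Noetherian `Y` and every `K` locally END on its cosupport with `singGE K m ≠ ∅` there are `c ≥ m` and an IRREDUCIBLE
COMPONENT `Z` of `singGE K c` such that `μ (Bl_Z Y, K₁) < μ (Y, K)` for the factor `K₁` of `K·𝒪 = (𝓘_Z·𝒪)^m · K₁`.  THEN for every `K`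
locally END on a regular Noetherian `X` the conclusion of `EndOrderReduction m` holds: a blow-up sequence with regular centres over
`singGE K m`, regular Noetherian top, `K·𝒪 = M · K₁` with `M` effective Cartier, `ord K₁ < m` everywhere, `K₁` locally END on its
cosupport, `cosupp K₁` over `cosupp K`.  (Well-founded induction on `μ`; the step is `endGlobalStep`; `singGE_factor_subset_preimage`
keeps the later centres over `singGE K m`.) [cite: BierstoneMilman2006, Thm. 8.5, Lemma 8.7] [cite: Kollar2007, (3.111) Step 3] -/
theorem endOrderReduction_of_wellFounded_componentChoice {Ω : Type v} [LT Ω] [WellFoundedLT Ω]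
    (μ : ∀ (Y : Scheme.{u}), Y.IdealSheafData → Ω) {m : ℕ} (hm : 1 ≤ m)
    (hσ : ∀ (Y : Scheme.{u}) [IsNoetherian Y], Scheme.IsRegular Y → ∀ (K : Y.IdealSheafData) (𝓛 : List Y.IdealSheafData),
      (∀ y ∈ (K.support : Set Y), IsEndNear K 𝓛 y) → (singGE K m).Nonempty →
      ∃ (c : ℕ) (Z : Set Y), m ≤ c ∧ IsIrreducible Z ∧ Z ⊆ singGE K c ∧
        (∀ Z' : Set Y, IsIrreducible Z' → Z ⊆ Z' → Z' ⊆ singGE K c → Z' = Z) ∧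
        ∀ (hZ : IsClosed Z) (K₁ : (blowup (vanishingIdeal ⟨Z, hZ⟩)).IdealSheafData),
          K.comap (blowup.π (vanishingIdeal ⟨Z, hZ⟩)) =
            ((vanishingIdeal ⟨Z, hZ⟩).comap (blowup.π (vanishingIdeal ⟨Z, hZ⟩))) ^ m * K₁ →
          μ (blowup (vanishingIdeal ⟨Z, hZ⟩)) K₁ < μ Y K)
    {X : Scheme.{u}} [IsNoetherian X] (hX : Scheme.IsRegular X) (K : X.IdealSheafData) (𝓛 : List X.IdealSheafData)
    (hEnd : ∀ x ∈ (K.support : Set X), IsEndNear K 𝓛 x) :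
    ∃ s : CentreSeq X, s.AllRegular ∧ s.CentresOver (singGE K m) ∧ Scheme.IsRegular s.top ∧
      ∃ (_ : IsNoetherian s.top) (M K₁ : s.top.IdealSheafData) (𝓛₁ : List s.top.IdealSheafData),
        K.comap s.comp = M * K₁ ∧ IsEffectiveCartier M ∧ (∀ x : s.top, idealOrder K₁ x < (m : ℕ∞)) ∧
        (∀ x ∈ (K₁.support : Set s.top), IsEndNear K₁ 𝓛₁ x) ∧
        (K₁.support : Set s.top) ⊆ s.comp ⁻¹' (K.support : Set X) := by
  -- well-founded induction on `μ X K`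
  suffices H : ∀ (o : Ω) {X : Scheme.{u}} [IsNoetherian X], Scheme.IsRegular X → ∀ (K : X.IdealSheafData)
      (𝓛 : List X.IdealSheafData), (∀ x ∈ (K.support : Set X), IsEndNear K 𝓛 x) → μ X K = o →
      ∃ s : CentreSeq X, s.AllRegular ∧ s.CentresOver (singGE K m) ∧ Scheme.IsRegular s.top ∧
        ∃ (_ : IsNoetherian s.top) (M K₁ : s.top.IdealSheafData) (𝓛₁ : List s.top.IdealSheafData),
          K.comap s.comp = M * K₁ ∧ IsEffectiveCartier M ∧ (∀ x : s.top, idealOrder K₁ x < (m : ℕ∞)) ∧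
          (∀ x ∈ (K₁.support : Set s.top), IsEndNear K₁ 𝓛₁ x) ∧
          (K₁.support : Set s.top) ⊆ s.comp ⁻¹' (K.support : Set X) from H (μ X K) hX K 𝓛 hEnd rfl
  intro o
  induction o using WellFoundedLT.induction with
  | _ o ih =>
    intro X _ hX K 𝓛 hEnd hμ
    by_cases hS : (singGE K m).Nonempty
    · -- one global move, then recurse
      obtain ⟨c, Z, hmc, hZirr, hZsub, hZmax, hdec⟩ := hσ X hX K 𝓛 hEnd hS
      obtain ⟨hZ, hreg, hN, M₁, K₁, 𝓛₁, hfac, hM₁, hM₁eq, hend₁, hsupp₁⟩ := endGlobalStep hX K 𝓛 hm hmc hEnd hZirr hZsub hZmax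
      have hCY : ((vanishingIdeal (⟨Z, hZ⟩ : Closeds X)).support : Set X) = Z :=
        Scheme.IdealSheafData.coe_support_vanishingIdeal (⟨Z, hZ⟩ : Closeds X)
      have hCreg : Scheme.IsRegular (vanishingIdeal (⟨Z, hZ⟩ : Closeds X)).subscheme :=
        (endSingComponentsRegular_holds X hX K 𝓛 c (hm.trans hmc) hEnd Z hZirr hZsub hZmax).2.1
      have hCsing : ((vanishingIdeal (⟨Z, hZ⟩ : Closeds X)).support : Set X) ⊆ singGE K m := by
        rw [hCY]; exact hZsub.trans (singGE_antitone K hmc)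
      have hlt : μ (blowup (vanishingIdeal (⟨Z, hZ⟩ : Closeds X))) K₁ < o := by
        rw [← hμ]
        exact hdec hZ K₁ (by rw [← hM₁eq]; exact hfac)
      haveI := hN
      obtain ⟨s₂, hs₂reg, hs₂over, hs₂top, hN₂, M₂, K₂, 𝓛₂, hfac₂, hM₂, hord₂, hend₂, hsupp₂⟩ :=
        ih _ hlt hreg K₁ 𝓛₁ hend₁ rfl
      refine ⟨.cons (vanishingIdeal (⟨Z, hZ⟩ : Closeds X)) s₂, ⟨hCreg, hs₂reg⟩, ⟨hCsing, ?_⟩, hs₂top, hN₂,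
        M₁.comap s₂.comp * M₂, K₂, 𝓛₂, ?_, (hM₁.comap_centreSeqComp s₂).mul hM₂, hord₂, hend₂, ?_⟩
      · exact CentreSeq.CentresOver.mono s₂ (singGE_factor_subset_preimage hCsing hfac) hs₂over
      · change K.comap (s₂.comp ≫ blowup.π (vanishingIdeal (⟨Z, hZ⟩ : Closeds X))) = M₁.comap s₂.comp * M₂ * K₂
        rw [Scheme.IdealSheafData.comap_comp, hfac, comap_mul, hfac₂, mul_assoc]
      · intro y hy
        change (s₂.comp ≫ blowup.π (vanishingIdeal (⟨Z, hZ⟩ : Closeds X))).base y ∈ (K.support : Set X)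
        rw [Scheme.Hom.comp_apply]
        exact hsupp₁ (hsupp₂ hy)
    · -- nothing to do
      refine ⟨.nil X, trivial, trivial, hX, (inferInstance : IsNoetherian X), ⊤, K, 𝓛, ?_, isEffectiveCartier_top,
        fun x => idealOrder_lt_of_not_mem_singGE K m fun hx => hS ⟨x, hx⟩, hEnd, fun x hx => hx⟩
      change K.comap (𝟙 X) = ⊤ * K
      rw [Scheme.IdealSheafData.comap_id, Scheme.IdealSheafData.top_mul]

/-- [OURS · L1 W5.2 · (iii′)] **THE GLOBAL ENGINE SOCKET UNDER (H-pt), WITH HISTORY.**  The same, the measure being allowed to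
depend on a HISTORY list `H` of ideal sheaves (the exceptional divisors so far), updated by strict transforms and the new exceptional
divisor: `H₁ = H.map (strictTransformIdeal π 𝓘_Z) ++ [𝓘_Z·𝒪]` (BGMW Def. 3.1.3 (4)) — the shape Bierstone–Milman-type invariants need.
Original statement:  Let `Ω` be well-founded and `μ : (Y, K) ↦ Ω`.  Suppose that for
every regular Noetherian `Y` and every `K` locally END on its cosupport with `singGE K m ≠ ∅` there are `c ≥ m` and an IRREDUCIBLE
COMPONENT `Z` of `singGE K c` such that `μ (Bl_Z Y, K₁) < μ (Y, K)` for the factor `K₁` of `K·𝒪 = (𝓘_Z·𝒪)^m · K₁`.  THEN for every `K`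
locally END on a regular Noetherian `X` the conclusion of `EndOrderReduction m` holds: a blow-up sequence with regular centres over
`singGE K m`, regular Noetherian top, `K·𝒪 = M · K₁` with `M` effective Cartier, `ord K₁ < m` everywhere, `K₁` locally END on its
cosupport, `cosupp K₁` over `cosupp K`.  (Well-founded induction on `μ`; the step is `endGlobalStep`; `singGE_factor_subset_preimage`
keeps the later centres over `singGE K m`.) [cite: BierstoneMilman2006, Thm. 8.5, Lemma 8.7] [cite: Kollar2007, (3.111) Step 3] -/
theorem endOrderReduction_of_wellFounded_componentChoice_history {Ω : Type v} [LT Ω] [WellFoundedLT Ω]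
    (μ : ∀ (Y : Scheme.{u}), Y.IdealSheafData → List Y.IdealSheafData → Ω) {m : ℕ} (hm : 1 ≤ m)
    (hσ : ∀ (Y : Scheme.{u}) [IsNoetherian Y], Scheme.IsRegular Y → ∀ (K : Y.IdealSheafData) (H 𝓛 : List Y.IdealSheafData),
      (∀ y ∈ (K.support : Set Y), IsEndNear K 𝓛 y) → (singGE K m).Nonempty →
      ∃ (c : ℕ) (Z : Set Y), m ≤ c ∧ IsIrreducible Z ∧ Z ⊆ singGE K c ∧
        (∀ Z' : Set Y, IsIrreducible Z' → Z ⊆ Z' → Z' ⊆ singGE K c → Z' = Z) ∧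
        ∀ (hZ : IsClosed Z) (K₁ : (blowup (vanishingIdeal ⟨Z, hZ⟩)).IdealSheafData),
          K.comap (blowup.π (vanishingIdeal ⟨Z, hZ⟩)) =
            ((vanishingIdeal ⟨Z, hZ⟩).comap (blowup.π (vanishingIdeal ⟨Z, hZ⟩))) ^ m * K₁ →
          μ (blowup (vanishingIdeal ⟨Z, hZ⟩)) K₁
              (H.map (strictTransformIdeal (blowup.π (vanishingIdeal ⟨Z, hZ⟩)) (vanishingIdeal ⟨Z, hZ⟩)) ++
                [(vanishingIdeal ⟨Z, hZ⟩).comap (blowup.π (vanishingIdeal ⟨Z, hZ⟩))]) < μ Y K H)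
    {X : Scheme.{u}} [IsNoetherian X] (hX : Scheme.IsRegular X) (K : X.IdealSheafData) (H 𝓛 : List X.IdealSheafData)
    (hEnd : ∀ x ∈ (K.support : Set X), IsEndNear K 𝓛 x) :
    ∃ s : CentreSeq X, s.AllRegular ∧ s.CentresOver (singGE K m) ∧ Scheme.IsRegular s.top ∧
      ∃ (_ : IsNoetherian s.top) (M K₁ : s.top.IdealSheafData) (𝓛₁ : List s.top.IdealSheafData),
        K.comap s.comp = M * K₁ ∧ IsEffectiveCartier M ∧ (∀ x : s.top, idealOrder K₁ x < (m : ℕ∞)) ∧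
        (∀ x ∈ (K₁.support : Set s.top), IsEndNear K₁ 𝓛₁ x) ∧
        (K₁.support : Set s.top) ⊆ s.comp ⁻¹' (K.support : Set X) := by
  -- well-founded induction on `μ X K`
  suffices HH : ∀ (o : Ω) {X : Scheme.{u}} [IsNoetherian X], Scheme.IsRegular X → ∀ (K : X.IdealSheafData)
      (H 𝓛 : List X.IdealSheafData), (∀ x ∈ (K.support : Set X), IsEndNear K 𝓛 x) → μ X K H = o →
      ∃ s : CentreSeq X, s.AllRegular ∧ s.CentresOver (singGE K m) ∧ Scheme.IsRegular s.top ∧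
        ∃ (_ : IsNoetherian s.top) (M K₁ : s.top.IdealSheafData) (𝓛₁ : List s.top.IdealSheafData),
          K.comap s.comp = M * K₁ ∧ IsEffectiveCartier M ∧ (∀ x : s.top, idealOrder K₁ x < (m : ℕ∞)) ∧
          (∀ x ∈ (K₁.support : Set s.top), IsEndNear K₁ 𝓛₁ x) ∧
          (K₁.support : Set s.top) ⊆ s.comp ⁻¹' (K.support : Set X) from HH (μ X K H) hX K H 𝓛 hEnd rfl
  intro o
  induction o using WellFoundedLT.induction with
  | _ o ih =>
    intro X _ hX K H 𝓛 hEnd hμ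
    by_cases hS : (singGE K m).Nonempty
    · -- one global move, then recurse
      obtain ⟨c, Z, hmc, hZirr, hZsub, hZmax, hdec⟩ := hσ X hX K H 𝓛 hEnd hS
      obtain ⟨hZ, hreg, hN, M₁, K₁, 𝓛₁, hfac, hM₁, hM₁eq, hend₁, hsupp₁⟩ := endGlobalStep hX K 𝓛 hm hmc hEnd hZirr hZsub hZmax
      have hCY : ((vanishingIdeal (⟨Z, hZ⟩ : Closeds X)).support : Set X) = Z :=
        Scheme.IdealSheafData.coe_support_vanishingIdeal (⟨Z, hZ⟩ : Closeds X)
      have hCreg : Scheme.IsRegular (vanishingIdeal (⟨Z, hZ⟩ : Closeds X)).subscheme :=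
        (endSingComponentsRegular_holds X hX K 𝓛 c (hm.trans hmc) hEnd Z hZirr hZsub hZmax).2.1
      have hCsing : ((vanishingIdeal (⟨Z, hZ⟩ : Closeds X)).support : Set X) ⊆ singGE K m := by
        rw [hCY]; exact hZsub.trans (singGE_antitone K hmc)
      have hlt : μ (blowup (vanishingIdeal (⟨Z, hZ⟩ : Closeds X))) K₁
          (H.map (strictTransformIdeal (blowup.π (vanishingIdeal (⟨Z, hZ⟩ : Closeds X))) (vanishingIdeal (⟨Z, hZ⟩ : Closeds X))) ++
            [(vanishingIdeal (⟨Z, hZ⟩ : Closeds X)).comap (blowup.π (vanishingIdeal (⟨Z, hZ⟩ : Closeds X)))]) < o := by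
        rw [← hμ]
        exact hdec hZ K₁ (by rw [← hM₁eq]; exact hfac)
      haveI := hN
      obtain ⟨s₂, hs₂reg, hs₂over, hs₂top, hN₂, M₂, K₂, 𝓛₂, hfac₂, hM₂, hord₂, hend₂, hsupp₂⟩ :=
        ih _ hlt hreg K₁ _ 𝓛₁ hend₁ rfl
      refine ⟨.cons (vanishingIdeal (⟨Z, hZ⟩ : Closeds X)) s₂, ⟨hCreg, hs₂reg⟩, ⟨hCsing, ?_⟩, hs₂top, hN₂,
        M₁.comap s₂.comp * M₂, K₂, 𝓛₂, ?_, (hM₁.comap_centreSeqComp s₂).mul hM₂, hord₂, hend₂, ?_⟩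
      · exact CentreSeq.CentresOver.mono s₂ (singGE_factor_subset_preimage hCsing hfac) hs₂over
      · change K.comap (s₂.comp ≫ blowup.π (vanishingIdeal (⟨Z, hZ⟩ : Closeds X))) = M₁.comap s₂.comp * M₂ * K₂
        rw [Scheme.IdealSheafData.comap_comp, hfac, comap_mul, hfac₂, mul_assoc]
      · intro y hy
        change (s₂.comp ≫ blowup.π (vanishingIdeal (⟨Z, hZ⟩ : Closeds X))).base y ∈ (K.support : Set X)
        rw [Scheme.Hom.comp_apply]
        exact hsupp₁ (hsupp₂ hy)
    · -- nothing to do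
      refine ⟨.nil X, trivial, trivial, hX, (inferInstance : IsNoetherian X), ⊤, K, 𝓛, ?_, isEffectiveCartier_top,
        fun x => idealOrder_lt_of_not_mem_singGE K m fun hx => hS ⟨x, hx⟩, hEnd, fun x hx => hx⟩
      change K.comap (𝟙 X) = ⊤ * K
      rw [Scheme.IdealSheafData.comap_id, Scheme.IdealSheafData.top_mul]

end Summit.ResolutionOfSingularities.ResolutionOfSingularities.Theorems.X3LemmaM

end
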